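import Summits.QuantumFields.BalabanUV.T4Continuum.Support.ScalarBlockPoincareLocal

/-!
# T⁴ programme, spine node NE2 (U1a), lane P2 — SUPPLIER ITEM (O8) «V-COL-LIFT»: the COMPONENTWISE LIFT of scalar quadratic-form inequalities to
# 0-forms with values in a finite-dimensional complex Hilbert space, and the `U = 1` BLOCK POINCARÉ INEQUALITY IN COLOUR

NE2 formalisation swarm `b2b-balaban-t4-ne2-formalise-*`, leaf prover 09 (gen 4); road owner t4-ne2-p2-g11's OPEN SUPPLIER ITEMS (CLAIMS.log l.10301) ∕
skeleton `t4/skeletons/NE2-t4-ne2-p2.md` v0.10 §2.E «V-COL … prerequisite of everything below».  V-COL's P⁺ member (coercivity in colour) transports a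
`U = 1` block Poincaré inequality along a frame; the tree's `U = 1` inequality `ScalarBlockPoincare.nsq_sub_PiS_le` (row B4.c, p207894) — and its coming
LOCAL sibling ((O6)(a), leaf-01) — are stated for ℂ-VALUED fields with MATRIX operators (`PiS`, `sdiff … *ᵥ f`).  This file is the variant-independent
bridge: scalar matrices act on `E`-valued fields componentwise (`mulVecv`), and ANY inequality between `ℓ²`-norms of such images that holds for all
scalar fields holds for all `E`-valued fields with the SAME constants (sum the scalar inequality over the coordinates in an orthonormal basis —
Parseval, `OrthonormalBasis.sum_sq_norm_inner_right`).
 * §1 `mulVecv A f i := Σ_j A i j • f j`; `inner_mulVecv` (coordinates commute with the action), `mulVecv_sub`∕`mulVecv_one`, `sum_norm_sq_eq_sum_nsq_inner`;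
 * §2 **`lift_quadratic_le_local`** (restricted sums `Σ_{x∈s_v}` on the right) and **`lift_quadratic_le`**:
   `(∀ g : ι → ℂ, nsq (A₀ *ᵥ g) ≤ Σ_v c_v·Σ_{x∈s_v}‖(B v *ᵥ g) x‖²) → ∀ f : ι → E, Σ_i‖mulVecv A₀ f i‖² ≤ Σ_v c_v·Σ_{x∈s_v}‖mulVecv (B v) f x‖²`;
 * §3 **`norm_sq_sub_PiS_le_colour`** (`ScalarBlockPoincare.nsq_sub_PiS_le`, row B4.c, BY NAME: `Σ_x ‖f x − (Π′f) x‖² ≤ 4d·Σ_ν Σ_x ‖(∂_ν f) x‖²`) and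
   **`norm_sq_sub_PiS_le_inBlock_colour`** (leaf-01's (O6)(a) `ScalarBlockPoincareLocal.nsq_sub_PiS_le_inBlock_blockOf`, p214854, BY NAME: in-block bonds only,
   constant `½`) for `f : Tor (fine n M) → E`; readings `mulVecv_sdiff` (`(∂_ν f)(x) = c·(f(x+e_ν) − f x)`), `mulVecv_PiS` (block mean).
NOT here: any transporter (this is the `U = 1` piece), the frame transport (the P⁺-colour member proper, global `VariationalCovariantPoincare` or local
`VariationalCovariantPoincareLocal` pattern — whoever files it imports this), NE3.

HONEST FRAMING (T4-DAG p. 1).  Pure finite-dimensional linear algebra ([folklore]); model level; nothing printed is a hypothesis; no `def … : Prop` fact;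
no `sorry`; axioms standard.  NE2 NOT proved; spine PROVED 0∕9 unchanged; rung (B)+1 finite T⁴ — NOT infinite volume, NOT a mass gap, NOT Clay.  HONEST
DEPENDENCY (cell, verbatim): continuum YM on T⁴ ⇐ BetaPertH ∧ nine spine estimates (0/9 proved); BetaPertH ⇐ (D1) ∧ (D4) ∧ CAP+tail; G-an2-4 gates asym,
D1 and NE2/3/4.
-/

noncomputable section

namespace Summit.QuantumFields.BalabanUV.T4Continuum.VariationalColourLift

open Finset Matrix
open scoped InnerProductSpace ComplexConjugate
open Literature.MathematicalPhysics.QuantumFieldTheory.Balaban1983to89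
open Literature.MathematicalPhysics.QuantumFieldTheory.Balaban1983to89.B5Prop11Plancherel (Tor fine unitVec)
open Literature.MathematicalPhysics.QuantumFieldTheory.Balaban1983to89.B5Prop11Lower (nsq)
open Literature.MathematicalPhysics.QuantumFieldTheory.Balaban1983to89.B5Action121 (sdiff sdiff_mulVec)
open Literature.MathematicalPhysics.QuantumFieldTheory.Balaban1983to89.B5Block118 (bpt QsOp QsOp_mulVec)
open Literature.MathematicalPhysics.QuantumFieldTheory.Balaban1983to89.B5Blocks16 (blockOf)
open Summit.QuantumFields.BalabanUV.T4Continuum.ScalarBlockPoincare (PiS PiS_mulVec nsq_sub_PiS_le)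
open Summit.QuantumFields.BalabanUV.T4Continuum.ScalarBlockPoincareLocal (nsq_sub_PiS_le_inBlock_blockOf)

variable {ι : Type*} [Fintype ι] [DecidableEq ι]
variable {E : Type*} [NormedAddCommGroup E] [InnerProductSpace ℂ E]

/-! ## §1 Scalar matrices acting on vector-valued fields -/

/-- a scalar matrix acting on an `E`-valued field componentwise: `(A·f)(i) = Σ_j A i j • f j`. [folklore] -/
def mulVecv (A : Matrix ι ι ℂ) (f : ι → E) : ι → E := fun i => ∑ j, A i j • f j

omit [DecidableEq ι] in
/-- coordinates commute with the componentwise action: `⟪e, (A·f) i⟫ = (A *ᵥ ⟪e, f ·⟫) i`. [folklore] -/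
theorem inner_mulVecv (e : E) (A : Matrix ι ι ℂ) (f : ι → E) (i : ι) :
    ⟪e, mulVecv A f i⟫_ℂ = (A *ᵥ fun j => ⟪e, f j⟫_ℂ) i := by
  simp only [mulVecv, inner_sum, inner_smul_right, Matrix.mulVec, dotProduct]

omit [DecidableEq ι] in
/-- the action is additive in the matrix. [folklore] -/
theorem mulVecv_sub (A B : Matrix ι ι ℂ) (f : ι → E) (i : ι) : mulVecv (A - B) f i = mulVecv A f i - mulVecv B f i := by
  simp only [mulVecv, Matrix.sub_apply, sub_smul, sum_sub_distrib]

/-- the identity matrix acts as the identity. [folklore] -/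
theorem mulVecv_one (f : ι → E) (i : ι) : mulVecv (1 : Matrix ι ι ℂ) f i = f i := by
  simp only [mulVecv, Matrix.one_apply, ite_smul, one_smul, zero_smul, sum_ite_eq, mem_univ, if_true]

omit [Fintype ι] [DecidableEq ι] in
/-- PARSEVAL for fields on a finset: `Σ_{i∈s} ‖f i‖² = Σ_k Σ_{i∈s} ‖⟪b k, f i⟫‖²` over an orthonormal basis `b`. [folklore] -/
theorem sum_norm_sq_eq_sum_inner {κ : Type*} [Fintype κ] (b : OrthonormalBasis κ ℂ E) (s : Finset ι) (f : ι → E) :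
    ∑ i ∈ s, ‖f i‖ ^ 2 = ∑ k, ∑ i ∈ s, ‖⟪b k, f i⟫_ℂ‖ ^ 2 := by
  rw [sum_comm]
  exact sum_congr rfl fun i _ => (b.sum_sq_norm_inner_right (f i)).symm

omit [DecidableEq ι] in
/-- PARSEVAL for fields: `Σ_i ‖f i‖² = Σ_k nsq (⟪b k, f ·⟫)`. [folklore] -/
theorem sum_norm_sq_eq_sum_nsq_inner {κ : Type*} [Fintype κ] (b : OrthonormalBasis κ ℂ E) (f : ι → E) :
    ∑ i, ‖f i‖ ^ 2 = ∑ k, nsq (fun i => ⟪b k, f i⟫_ℂ) :=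
  sum_norm_sq_eq_sum_inner b univ f

/-! ## §2 The lift -/

omit [DecidableEq ι] in
/-- **THE COMPONENTWISE LIFT, LOCAL FORM**: a scalar inequality `nsq (A₀ g) ≤ Σ_v c_v·Σ_{x∈s_v} ‖(B_v g) x‖²` (restricted sums on the right — e.g. in-block
bonds only) valid for EVERY scalar field `g` holds, with the same constants and the same index sets, for every field with values in a finite-dimensional
complex Hilbert space (sum over the coordinates in an orthonormal basis). [folklore] -/
theorem lift_quadratic_le_local [FiniteDimensional ℂ E] {υ : Type*} [Fintype υ] (A₀ : Matrix ι ι ℂ) (B : υ → Matrix ι ι ℂ) (c : υ → ℝ)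
    (s : υ → Finset ι) (h : ∀ g : ι → ℂ, nsq (A₀ *ᵥ g) ≤ ∑ v, c v * ∑ x ∈ s v, ‖(B v *ᵥ g) x‖ ^ 2) (f : ι → E) :
    ∑ i, ‖mulVecv A₀ f i‖ ^ 2 ≤ ∑ v, c v * ∑ x ∈ s v, ‖mulVecv (B v) f x‖ ^ 2 := by
  set b := stdOrthonormalBasis ℂ E
  have hcomp : ∀ (k) (A : Matrix ι ι ℂ) (i), ⟪b k, mulVecv A f i⟫_ℂ = (A *ᵥ fun j => ⟪b k, f j⟫_ℂ) i :=
    fun k A i => inner_mulVecv _ _ _ _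
  rw [sum_norm_sq_eq_sum_nsq_inner b]
  calc ∑ k, nsq (fun i => ⟪b k, mulVecv A₀ f i⟫_ℂ) = ∑ k, nsq (A₀ *ᵥ fun j => ⟪b k, f j⟫_ℂ) :=
        sum_congr rfl fun k _ => by simp_rw [hcomp]
    _ ≤ ∑ k, ∑ v, c v * ∑ x ∈ s v, ‖(B v *ᵥ fun j => ⟪b k, f j⟫_ℂ) x‖ ^ 2 := sum_le_sum fun k _ => h _
    _ = ∑ v, c v * ∑ x ∈ s v, ‖mulVecv (B v) f x‖ ^ 2 := by
        rw [sum_comm]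
        refine sum_congr rfl fun v _ => ?_
        rw [sum_norm_sq_eq_sum_inner b (s v), mul_sum]
        simp_rw [hcomp]

omit [DecidableEq ι] in
/-- **THE COMPONENTWISE LIFT**: a scalar inequality `nsq (A₀ g) ≤ Σ_v c_v·nsq (B_v g)` valid for EVERY scalar field `g` holds, with the same constants,
for every field with values in a finite-dimensional complex Hilbert space. [folklore] -/
theorem lift_quadratic_le [FiniteDimensional ℂ E] {υ : Type*} [Fintype υ] (A₀ : Matrix ι ι ℂ) (B : υ → Matrix ι ι ℂ) (c : υ → ℝ)
    (h : ∀ g : ι → ℂ, nsq (A₀ *ᵥ g) ≤ ∑ v, c v * nsq (B v *ᵥ g)) (f : ι → E) :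
    ∑ i, ‖mulVecv A₀ f i‖ ^ 2 ≤ ∑ v, c v * ∑ i, ‖mulVecv (B v) f i‖ ^ 2 :=
  lift_quadratic_le_local A₀ B c (fun _ => univ) (fun g => by simpa only [nsq] using h g) f

/-! ## §3 The `U = 1` block Poincaré inequality in colour -/

section Blocks

variable {d : ℕ} (n : ℕ) [NeZero n] (M : Fin d → ℕ) [hM : ∀ μ, NeZero (M μ)]

/-- the colour forward difference: `(∂_ν f)(x) = c • (f(x + e_ν) − f x)` (`sdiff` acting componentwise). [folklore] -/
theorem mulVecv_sdiff {N : Fin d → ℕ} [∀ μ, NeZero (N μ)] (c : ℂ) (ν : Fin d) (f : Tor N → E) (x : Tor N) :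
    mulVecv (sdiff N c ν) f x = c • (f (x + unitVec N ν) - f x) := by
  refine ext_inner_left ℂ fun e => ?_
  rw [inner_mulVecv, sdiff_mulVec, inner_smul_right, inner_sub_right]

/-- the colour block mean: `(Π′f)(x) = n^{−d} • Σ_j f(bpt (block of x) j)` (`PiS` acting componentwise). [folklore] -/
theorem mulVecv_PiS (f : Tor (fine n M) → E) (x : Tor (fine n M)) :
    mulVecv (PiS n M) f x = ((1 : ℂ) / (n : ℂ) ^ d) • ∑ j : Fin d → Fin n, f (bpt n M (blockOf n M x) j) := by
  refine ext_inner_left ℂ fun e => ?_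
  rw [inner_mulVecv, PiS_mulVec, QsOp_mulVec, inner_smul_right, inner_sum]

/-- **THE `U = 1` BLOCK POINCARÉ INEQUALITY IN COLOUR** (row B4.c's `ScalarBlockPoincare.nsq_sub_PiS_le` BY NAME, lifted): for every field `f` with values
in a finite-dimensional complex Hilbert space, `Σ_x ‖f x − (Π′f) x‖² ≤ 4d·Σ_ν Σ_x ‖(∂_ν f)(x)‖²` (`∂_ν = sdiff (fine n M) n ν`, lattice factor `n`). [folklore] -/
theorem norm_sq_sub_PiS_le_colour [FiniteDimensional ℂ E] (f : Tor (fine n M) → E) :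
    ∑ x, ‖f x - mulVecv (PiS n M) f x‖ ^ 2 ≤ 4 * d * ∑ ν, ∑ x, ‖mulVecv (sdiff (fine n M) (n : ℂ) ν) f x‖ ^ 2 := by
  have hscalar : ∀ g : Tor (fine n M) → ℂ,
      nsq ((1 - PiS n M) *ᵥ g) ≤ ∑ ν, (4 * d : ℝ) * nsq (sdiff (fine n M) (n : ℂ) ν *ᵥ g) := by
    intro g
    rw [Matrix.sub_mulVec, Matrix.one_mulVec, ← mul_sum]
    exact nsq_sub_PiS_le n M g
  have h := lift_quadratic_le (E := E) (1 - PiS n M) (fun ν => sdiff (fine n M) (n : ℂ) ν) (fun _ => (4 * d : ℝ)) hscalar f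
  simp_rw [mulVecv_sub, mulVecv_one] at h
  rwa [← mul_sum] at h

/-- **THE IN-BLOCK (LOCAL) POINCARÉ INEQUALITY IN COLOUR** (leaf-01's (O6)(a) `ScalarBlockPoincareLocal.nsq_sub_PiS_le_inBlock_blockOf` BY NAME, lifted):
`Σ_x ‖f x − (Π′f) x‖² ≤ ½·Σ_ν Σ_{x : x + e_ν in the block of x} ‖(∂_ν f)(x)‖²` — only IN-BLOCK bonds on the right, constant `½`, same index sets. [folklore] -/
theorem norm_sq_sub_PiS_le_inBlock_colour [FiniteDimensional ℂ E] (f : Tor (fine n M) → E) :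
    ∑ x, ‖f x - mulVecv (PiS n M) f x‖ ^ 2
      ≤ 1 / 2 * ∑ ν : Fin d, ∑ x ∈ univ.filter (fun x : Tor (fine n M) => blockOf n M (x + unitVec (fine n M) ν) = blockOf n M x),
          ‖mulVecv (sdiff (fine n M) (n : ℂ) ν) f x‖ ^ 2 := by
  have hscalar : ∀ g : Tor (fine n M) → ℂ, nsq ((1 - PiS n M) *ᵥ g)
      ≤ ∑ ν : Fin d, (1 / 2 : ℝ) * ∑ x ∈ univ.filter (fun x : Tor (fine n M) => blockOf n M (x + unitVec (fine n M) ν) = blockOf n M x),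
          ‖(sdiff (fine n M) (n : ℂ) ν *ᵥ g) x‖ ^ 2 := by
    intro g
    rw [Matrix.sub_mulVec, Matrix.one_mulVec, ← mul_sum]
    exact nsq_sub_PiS_le_inBlock_blockOf n M g
  have h := lift_quadratic_le_local (E := E) (1 - PiS n M) (fun ν => sdiff (fine n M) (n : ℂ) ν) (fun _ => (1 / 2 : ℝ))
    (fun ν => univ.filter (fun x : Tor (fine n M) => blockOf n M (x + unitVec (fine n M) ν) = blockOf n M x)) hscalar f
  simp_rw [mulVecv_sub, mulVecv_one] at h
  rwa [← mul_sum] at h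

end Blocks

end Summit.QuantumFields.BalabanUV.T4Continuum.VariationalColourLift

end
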